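import Summits.MatrixMultiplication.OmegaCensus.DominoZpZpConsistAlg
import Summits.MatrixMultiplication.OmegaCensus.DominoZpZpCells
import HarnessLib

/-!
# No domino cube law over `A ↠ ℤ_p × ℤ_p` from a moment-consistency certificate (generic in the prime `p ≥ 5`)

ω-census `pub-omega`, family (b3), seat pub-omega-group gen 27.  Framing: lottery ticket; floor = certified bounds/negative
ranges.  VALUE: the generic theorem of the SHADOW-CONSISTENCY route (G5; programs in `DominoZpZpConsistCheck.lean`, algebra in
`DominoZpZpConsistAlg.lean`): a `ℤ_p²` domino cell is closed by (i) a COMPLETENESS certificate — every line key `F` of size `d` with a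
solution `(G, s)` of the normalised line identity (constant `K = |A|/p`) has `(F, s)` LISTED in `Lst` (instances discharge this with
the unit / pair / sign / Farkas certificates of `DominoLineUnitObstruction*.lean`, `DominoLineSignCertificate.lean`,
`DominoZ5LineTables.lean`), (ii) a REPRESENTATIVE certificate — every listed pair is a unit scaling of one in `L0` (`repCheck`), and
(iii) the kernel verdict `rowDead p M Lst L0 T₀ = true` for every `T₀ ∈ L0`; NOT progress on ω.

Proof: the two coordinate shadows of `X` (after a diagonal change of basis `diag(k₁, k₂)` of `ℤ_p²` putting them in `L0`) and the
`p − 1` shadows in the directions `u ↦ c·u.1 + u.2` are all listed (`shadowL_mem`), their shifts are `c·s₀ + s₁`, and their power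
moments obey the Lagrange prediction rule (`moment_split`, `momPoly_eval_eq_sum`) — exactly the digit data that `pairDead_sound`
says cannot exist when the checker answers `true`.

* `no_shifted_form_of_onto_zpzp_consist_core` (a surjection whose coordinate shadows are given pointwise),
* `no_shifted_form_of_onto_zpzp_of_consist` (any surjection; rescaling),
* `no_law_cube_1de_of_onto_zpzp_of_consist` / `no_law_cube_1d_e_of_onto_zpzp_of_consist` (TPP level, dihedral-like `G`, any `c₀`).
-/

namespace Summit.MatrixMultiplication.OmegaCensus

open Finset

namespace ZpZpDomino

/-- Two naturals below `p` with equal casts in `ZMod p` are equal. [folklore] -/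
private theorem cast_inj_lt {p : ℕ} {a b : ℕ} (ha : a < p) (hb : b < p) (h : (a : ZMod p) = b) : a = b := by
  have h1 := congrArg ZMod.val h
  rwa [ZMod.val_natCast, ZMod.val_natCast, Nat.mod_eq_of_lt ha, Nat.mod_eq_of_lt hb] at h1

/-- `rcode` of a key is the `dcode` of any digit function agreeing with its moments from index `1` on. [folklore] -/
theorem rcode_eq_dcode {p : ℕ} (F : List ℕ) (g : ℕ → ℕ) (hg : ∀ j, 1 ≤ j → g j = momN p F j) :
    ∀ ℓ, rcode p F ℓ = dcode p g ℓ
  | 0 => rfl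
  | ℓ + 1 => by rw [rcode, dcode, rcode_eq_dcode F g hg ℓ, hg (ℓ + 1) (by omega)]

/-- `momN` is a residue. [folklore] -/
theorem momN_lt {p : ℕ} (hp : 0 < p) (F : List ℕ) (m : ℕ) : momN p F m < p := Nat.mod_lt _ hp

/-- `predDigit` is a residue. [folklore] -/
theorem predDigit_lt {p : ℕ} (hp : 0 < p) (LC : List (List (List ℕ))) (m c am bm : ℕ) (R : List ℕ) :
    predDigit p LC m c am bm R < p := Nat.mod_lt _ hp

/-! ## The core theorem -/

section Core

variable {p : ℕ} [Fact p.Prime] {A : Type*} [AddCommGroup A] [DecidableEq A] [Fintype A]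

/-- **Core**: a shifted form, a surjection `Ψ : A ↠ ℤ_p²` whose two coordinate shadows (with their shifts) are described pointwise by
`T₀`, `T₁`, completeness of `Lst`, and the kernel verdict `pairDead … T₀ T₁ = true` are contradictory. [folklore] -/
theorem no_shifted_form_of_onto_zpzp_consist_core (η : ZMod p) (hη : η + η = 1) (Ψ : A →+ ZMod p × ZMod p)
    (hΨ : Function.Surjective Ψ) {X Y : Finset A} {β γ x₀ : A} {d K M : ℕ} (hXd : X.card = d)
    (hA : Fintype.card A = p * K) (Lst : List (List ℕ × ℕ)) (hM : 2 ≤ M ∧ M < p) (hinv : invCheck p M = true)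
    (hcomp : ∀ F ∈ compsLB [] p d, ∀ (G : ZMod p → ℕ) (s : ZMod p),
      (∀ τ : ZMod p, (∑ v : ZMod p, (vecFn F (τ - v) + vecFn F (v - τ) + vecFn F (τ + v)) * G v) +
        (if s = τ then 1 else 0) = K) → (F, s.val) ∈ Lst)
    (T₀ T₁ : List ℕ × ℕ)
    (hT₀F : ∀ v : ZMod p, T₀.1.getD v.val 0 = (X.filter fun a => (Ψ a - η • Ψ β).1 = v).card)
    (hT₀s : ((T₀.2 : ℕ) : ZMod p) = (Ψ x₀ - η • Ψ β - η • Ψ γ).1)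
    (hT₁F : ∀ v : ZMod p, T₁.1.getD v.val 0 = (X.filter fun a => (Ψ a - η • Ψ β).2 = v).card)
    (hT₁s : ((T₁.2 : ℕ) : ZMod p) = (Ψ x₀ - η • Ψ β - η • Ψ γ).2)
    (hdead : pairDead p M (masksOf p M Lst) (lagTab p M) T₀ T₁ = true)
    (hinj : Set.InjOn (fun q : A × A => q.1 + q.2) ↑(X ×ˢ Y))
    (hPQ : Disjoint ((X ×ˢ Y).image fun q : A × A => q.1 + q.2)
      (((Y ×ˢ X).image fun q : A × A => q.1 - q.2).image fun z => z + β))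
    (hPR : Disjoint ((X ×ˢ Y).image fun q : A × A => q.1 + q.2)
      (((X ×ˢ Y).image fun q : A × A => q.1 - q.2).image fun z => z + γ))
    (hQR : Disjoint (((Y ×ˢ X).image fun q : A × A => q.1 - q.2).image fun z => z + β)
      (((X ×ˢ Y).image fun q : A × A => q.1 - q.2).image fun z => z + γ))
    (hcover : ((X ×ˢ Y).image fun q : A × A => q.1 + q.2) ∪
      (((Y ×ˢ X).image fun q : A × A => q.1 - q.2).image fun z => z + β) ∪
      (((X ×ˢ Y).image fun q : A × A => q.1 - q.2).image fun z => z + γ) = univ.erase x₀) : False := by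
  classical
  have hp : 0 < p := (Fact.out : p.Prime).pos
  set u : A → ZMod p × ZMod p := fun a => Ψ a - η • Ψ β with hu
  set w₀ : ZMod p × ZMod p := Ψ x₀ - η • Ψ β - η • Ψ γ with hw₀
  set μ : ℕ → ℕ → ZMod p := mixedMoment u X with hμ
  -- moments of the coordinate data
  have ha : ∀ m, ((momN p T₀.1 m : ℕ) : ZMod p) = μ m 0 := fun m => by
    rw [momN_cast, hμ, ← shadow_moment_fst u X m]
    exact Finset.sum_congr rfl fun v _ => by rw [hT₀F v]
  have hb : ∀ m, ((momN p T₁.1 m : ℕ) : ZMod p) = μ 0 m := fun m => by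
    rw [momN_cast, hμ, ← shadow_moment_snd u X m]
    exact Finset.sum_congr rfl fun v _ => by rw [hT₁F v]
  -- the true digit data of the directions `c = c' + 1`
  set dig : ℕ → ℕ → ℕ := fun c' ℓ =>
    if ℓ = 0 then (lmap (((c' + 1 : ℕ) : ZMod p)) 1 w₀).val else momN p (shadowL u X (((c' + 1 : ℕ) : ZMod p)) 1) ℓ with hdig
  have hdig0 : ∀ c', dig c' 0 = (lmap (((c' + 1 : ℕ) : ZMod p)) 1 w₀).val := fun c' => by rw [hdig]; exact if_pos rfl
  have hdigS : ∀ c' ℓ, 1 ≤ ℓ → dig c' ℓ = momN p (shadowL u X (((c' + 1 : ℕ) : ZMod p)) 1) ℓ := fun c' ℓ hℓ => by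
    rw [hdig]; exact if_neg (by omega)
  have hlt : ∀ c' ℓ, dig c' ℓ < p := fun c' ℓ => by
    by_cases hℓ : ℓ = 0
    · rw [hℓ, hdig0]; exact ZMod.val_lt _
    · rw [hdigS c' ℓ (by omega)]; exact momN_lt hp _ _
  have hdigC : ∀ c' m, 1 ≤ m → ((dig c' m : ℕ) : ZMod p) =
      μ 0 m + (momPoly m μ).eval (((c' + 1 : ℕ) : ZMod p)) + (((c' + 1 : ℕ) : ZMod p)) ^ m * μ m 0 := fun c' m hm => by
    rw [hdigS c' m hm]; exact moment_split u X _ hm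
  refine pairDead_sound hp (by omega) hM.2 dig hlt (fun c' _ => ?_) (fun c' _ => ?_)
    (fun m hm2 hmM c' _ hc => ?_) (fun c' hc ℓ hℓ1 hℓM => ?_) hdead
  · -- shifts
    refine cast_inj_lt (hlt c' 0) (Nat.mod_lt _ hp) ?_
    rw [hdig0, ZMod.natCast_zmod_val, ZMod.natCast_mod, lmap_apply]
    push_cast
    rw [hT₀s, hT₁s]; ring
  · -- first digits
    refine cast_inj_lt (hlt c' 1) (Nat.mod_lt _ hp) ?_
    rw [hdigC c' 1 le_rfl, ZMod.natCast_mod, momPoly_eval]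
    push_cast
    rw [ha, hb]
    simp only [Finset.range_one, Finset.erase_singleton, Finset.sum_empty, add_zero, pow_one]
    ring
  · -- the prediction rule
    refine cast_inj_lt (hlt c' m) (predDigit_lt hp _ _ _ _ _ _) ?_
    rw [hdigC c' m (by omega), predDigit_cast hinv hM.2 hm2 hmM hc, ha, hb]
    have hR : ∀ i' ∈ Finset.range (m - 1),
        (((pivotR p m (momN p T₀.1 m) (momN p T₁.1 m) ((List.range (m - 1)).map fun i' => dig i' m)).getD i' 0 : ℕ) :
          ZMod p) = (momPoly m μ).eval (((i' + 1 : ℕ) : ZMod p)) := by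
      intro i' hi'
      have hi'' := Finset.mem_range.1 hi'
      rw [pivotR_cast hi'', getD_map_range _ hi'', hdigC i' m (by omega), ha, hb]
      ring
    rw [Finset.sum_congr rfl fun i' hi' => by rw [hR i' hi'], ← momPoly_eval_eq_sum (by omega) (by omega) μ]
    ring
  · -- presence: the direction is listed
    have hmem := shadowL_mem η hη Ψ hΨ hXd hA Lst hcomp hinj hPQ hPR hQR hcover (((c' + 1 : ℕ) : ZMod p)) 1
      (Or.inr one_ne_zero)
    have h := testBit_masksOf (M := M) hmem (ℓ' := ℓ - 1) (by omega) hp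
    rw [Nat.sub_add_cancel hℓ1, Nat.mod_eq_of_lt (ZMod.val_lt _)] at h
    rw [hdig0, ← rcode_eq_dcode _ (dig c') (fun j hj => hdigS c' j hj) ℓ]
    exact h

/-- **Main theorem (shifted-form level)**: no shifted form over any `Φ : A ↠ ℤ_p × ℤ_p` once the instance supplies completeness of
`Lst`, representatives `L0` and the kernel verdicts `rowDead`. [folklore] -/
theorem no_shifted_form_of_onto_zpzp_of_consist (η : ZMod p) (hη : η + η = 1) (Φ : A →+ ZMod p × ZMod p)
    (hΦ : Function.Surjective Φ) {X Y : Finset A} {β γ x₀ : A} {d K M : ℕ} (hXd : X.card = d)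
    (hA : Fintype.card A = p * K) (Lst L0 : List (List ℕ × ℕ)) (hM : 2 ≤ M ∧ M < p) (hinv : invCheck p M = true)
    (hrows : ∀ T₀ ∈ L0, rowDead p M Lst L0 T₀ = true)
    (hcomp : ∀ F ∈ compsLB [] p d, ∀ (G : ZMod p → ℕ) (s : ZMod p),
      (∀ τ : ZMod p, (∑ v : ZMod p, (vecFn F (τ - v) + vecFn F (v - τ) + vecFn F (τ + v)) * G v) +
        (if s = τ then 1 else 0) = K) → (F, s.val) ∈ Lst)
    (hrep : ∀ T ∈ Lst, ∃ k : ℕ, k % p ≠ 0 ∧ ∃ T' ∈ L0, T'.2 % p = k * T.2 % p ∧ ∀ v < p, T'.1.getD (k * v % p) 0 = T.1.getD v 0)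
    (hinj : Set.InjOn (fun q : A × A => q.1 + q.2) ↑(X ×ˢ Y))
    (hPQ : Disjoint ((X ×ˢ Y).image fun q : A × A => q.1 + q.2)
      (((Y ×ˢ X).image fun q : A × A => q.1 - q.2).image fun z => z + β))
    (hPR : Disjoint ((X ×ˢ Y).image fun q : A × A => q.1 + q.2)
      (((X ×ˢ Y).image fun q : A × A => q.1 - q.2).image fun z => z + γ))
    (hQR : Disjoint (((Y ×ˢ X).image fun q : A × A => q.1 - q.2).image fun z => z + β)
      (((X ×ˢ Y).image fun q : A × A => q.1 - q.2).image fun z => z + γ))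
    (hcover : ((X ×ˢ Y).image fun q : A × A => q.1 + q.2) ∪
      (((Y ×ˢ X).image fun q : A × A => q.1 - q.2).image fun z => z + β) ∪
      (((X ×ˢ Y).image fun q : A × A => q.1 - q.2).image fun z => z + γ) = univ.erase x₀) : False := by
  classical
  have hp : 0 < p := (Fact.out : p.Prime).pos
  -- the coordinate shadows of `Φ` are listed; pick their representatives
  have m0 := shadowL_mem η hη Φ hΦ hXd hA Lst hcomp hinj hPQ hPR hQR hcover (1 : ZMod p) 0 (Or.inl one_ne_zero)
  have m1 := shadowL_mem η hη Φ hΦ hXd hA Lst hcomp hinj hPQ hPR hQR hcover (0 : ZMod p) 1 (Or.inr one_ne_zero)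
  obtain ⟨k₁, hk₁, T₀, hT₀, hs₀, hF₀⟩ := hrep _ m0
  obtain ⟨k₂, hk₂, T₁, hT₁, hs₁, hF₁⟩ := hrep _ m1
  set κ₁ : ZMod p := ((k₁ : ℕ) : ZMod p) with hκ₁
  set κ₂ : ZMod p := ((k₂ : ℕ) : ZMod p) with hκ₂
  have hκ₁0 : κ₁ ≠ 0 := by
    rw [hκ₁, ne_eq, ZMod.natCast_eq_zero_iff]; exact fun hd => hk₁ (Nat.mod_eq_zero_of_dvd hd)
  have hκ₂0 : κ₂ ≠ 0 := by
    rw [hκ₂, ne_eq, ZMod.natCast_eq_zero_iff]; exact fun hd => hk₂ (Nat.mod_eq_zero_of_dvd hd)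
  -- rescale: `Ψ = diag(κ₁, κ₂) ∘ Φ`
  set D : ZMod p × ZMod p →+ ZMod p × ZMod p :=
    (AddMonoidHom.mulLeft κ₁).prodMap (AddMonoidHom.mulLeft κ₂) with hD
  have eD : ∀ x : ZMod p × ZMod p, D x = (κ₁ * x.1, κ₂ * x.2) := fun x => rfl
  set Ψ : A →+ ZMod p × ZMod p := D.comp Φ with hΨ
  have eΨ : ∀ a, Ψ a = (κ₁ * (Φ a).1, κ₂ * (Φ a).2) := fun a => rfl
  have hΨs : Function.Surjective Ψ := by
    intro y
    obtain ⟨a, ha⟩ := hΦ (κ₁⁻¹ * y.1, κ₂⁻¹ * y.2)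
    refine ⟨a, ?_⟩
    rw [eΨ, ha]
    ext <;> simp [← mul_assoc, mul_inv_cancel₀ hκ₁0, mul_inv_cancel₀ hκ₂0]
  have eu : ∀ a, Ψ a - η • Ψ β = (κ₁ * (Φ a - η • Φ β).1, κ₂ * (Φ a - η • Φ β).2) := fun a => by
    rw [eΨ, eΨ]; ext <;> simp <;> ring
  have ew : Ψ x₀ - η • Ψ β - η • Ψ γ = (κ₁ * (Φ x₀ - η • Φ β - η • Φ γ).1, κ₂ * (Φ x₀ - η • Φ β - η • Φ γ).2) := by
    rw [eΨ, eΨ, eΨ]; ext <;> simp <;> ring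
  have hdead : pairDead p M (masksOf p M Lst) (lagTab p M) T₀ T₁ = true := by
    have h := hrows T₀ hT₀
    unfold rowDead at h
    rw [List.all_eq_true] at h
    exact h T₁ hT₁
  refine no_shifted_form_of_onto_zpzp_consist_core η hη Ψ hΨs hXd hA Lst hM hinv hcomp T₀ T₁
    (fun v => ?_) ?_ (fun v => ?_) ?_ hdead hinj hPQ hPR hQR hcover
  · -- first-coordinate shadow of `Ψ` = `k₁`-scaling of that of `Φ`
    have e1 := hF₀ (κ₁⁻¹ * v).val (ZMod.val_lt _)
    have ev : k₁ * (κ₁⁻¹ * v).val % p = v.val := by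
      have : (((k₁ * (κ₁⁻¹ * v).val : ℕ)) : ZMod p) = v := by
        push_cast; rw [ZMod.natCast_zmod_val, ← hκ₁, ← mul_assoc, mul_inv_cancel₀ hκ₁0, one_mul]
      rw [← ZMod.val_natCast, this]
    rw [ev] at e1
    rw [e1, getD_shadowL]
    refine congrArg Finset.card (Finset.filter_congr fun a _ => ?_)
    rw [lmap_apply, one_mul, zero_mul, add_zero, eu]
    constructor
    · intro e; rw [e, ← mul_assoc, mul_inv_cancel₀ hκ₁0, one_mul]
    · intro e; rw [← e, ← mul_assoc, inv_mul_cancel₀ hκ₁0, one_mul]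
  · have e := (ZMod.natCast_eq_natCast_iff' _ _ p).2 hs₀
    simp only [Nat.cast_mul, ZMod.natCast_zmod_val, lmap_apply, one_mul, zero_mul, add_zero] at e
    rw [e, ew]
  · have e1 := hF₁ (κ₂⁻¹ * v).val (ZMod.val_lt _)
    have ev : k₂ * (κ₂⁻¹ * v).val % p = v.val := by
      have : (((k₂ * (κ₂⁻¹ * v).val : ℕ)) : ZMod p) = v := by
        push_cast; rw [ZMod.natCast_zmod_val, ← hκ₂, ← mul_assoc, mul_inv_cancel₀ hκ₂0, one_mul]
      rw [← ZMod.val_natCast, this]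
    rw [ev] at e1
    rw [e1, getD_shadowL]
    refine congrArg Finset.card (Finset.filter_congr fun a _ => ?_)
    rw [lmap_apply, one_mul, zero_mul, zero_add, eu]
    constructor
    · intro e; rw [e, ← mul_assoc, mul_inv_cancel₀ hκ₂0, one_mul]
    · intro e; rw [← e, ← mul_assoc, inv_mul_cancel₀ hκ₂0, one_mul]
  · have e := (ZMod.natCast_eq_natCast_iff' _ _ p).2 hs₁
    simp only [Nat.cast_mul, ZMod.natCast_zmod_val, lmap_apply, one_mul, zero_mul, zero_add] at e
    rw [e, ew]

/-- **Main theorem, parts swapped** (the listed part is `Y`): the shifted form is symmetric under `(X, β) ↔ (Y, γ)`. [folklore] -/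
theorem no_shifted_form_of_onto_zpzp_of_consist' (η : ZMod p) (hη : η + η = 1) (Φ : A →+ ZMod p × ZMod p)
    (hΦ : Function.Surjective Φ) {X Y : Finset A} {β γ x₀ : A} {e K M : ℕ} (hYe : Y.card = e)
    (hA : Fintype.card A = p * K) (Lst L0 : List (List ℕ × ℕ)) (hM : 2 ≤ M ∧ M < p) (hinv : invCheck p M = true)
    (hrows : ∀ T₀ ∈ L0, rowDead p M Lst L0 T₀ = true)
    (hcomp : ∀ F ∈ compsLB [] p e, ∀ (G : ZMod p → ℕ) (s : ZMod p),
      (∀ τ : ZMod p, (∑ v : ZMod p, (vecFn F (τ - v) + vecFn F (v - τ) + vecFn F (τ + v)) * G v) +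
        (if s = τ then 1 else 0) = K) → (F, s.val) ∈ Lst)
    (hrep : ∀ T ∈ Lst, ∃ k : ℕ, k % p ≠ 0 ∧ ∃ T' ∈ L0, T'.2 % p = k * T.2 % p ∧ ∀ v < p, T'.1.getD (k * v % p) 0 = T.1.getD v 0)
    (hinj : Set.InjOn (fun q : A × A => q.1 + q.2) ↑(X ×ˢ Y))
    (hPQ : Disjoint ((X ×ˢ Y).image fun q : A × A => q.1 + q.2)
      (((Y ×ˢ X).image fun q : A × A => q.1 - q.2).image fun z => z + β))
    (hPR : Disjoint ((X ×ˢ Y).image fun q : A × A => q.1 + q.2)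
      (((X ×ˢ Y).image fun q : A × A => q.1 - q.2).image fun z => z + γ))
    (hQR : Disjoint (((Y ×ˢ X).image fun q : A × A => q.1 - q.2).image fun z => z + β)
      (((X ×ˢ Y).image fun q : A × A => q.1 - q.2).image fun z => z + γ))
    (hcover : ((X ×ˢ Y).image fun q : A × A => q.1 + q.2) ∪
      (((Y ×ˢ X).image fun q : A × A => q.1 - q.2).image fun z => z + β) ∪
      (((X ×ˢ Y).image fun q : A × A => q.1 - q.2).image fun z => z + γ) = univ.erase x₀) : False := by
  have himg := image_add_swap X Y
  refine no_shifted_form_of_onto_zpzp_of_consist η hη Φ hΦ (X := Y) (Y := X) (β := γ) (γ := β) (x₀ := x₀) hYe hA Lst L0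
    hM hinv hrows hcomp hrep (injOn_add_swap hinj) ?_ ?_ hQR.symm ?_
  · rw [himg]; exact hPR
  · rw [himg]; exact hPQ
  · rw [himg, union_right_comm]; exact hcover

end Core

/-! ## The TPP statements -/

section DihedralLike

open Literature.Combinatorics.Additive

variable {p : ℕ} [Fact p.Prime] {A : Type} [AddCommGroup A] [DecidableEq A] [Fintype A] {G : Type} [Group G]
  [DecidableEq G] {ρ τ : A → G} {c₀ : A} {S T U : Finset G}

/-- **No `(1,1 | d,d | e,e)` law triple over `A ↠ ℤ_p × ℤ_p` (`|A| = p·K`) from a consistency certificate for part `d`**: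
dihedral-like `G` over `A` (any `c₀`), `φ` onto, TPP, coset parts `(1,1 | d,d | e,e)` ⇒ `3|S||T||U| + 8 ≠ 8|A|`. [folklore] -/
theorem no_law_cube_1de_of_onto_zpzp_of_consist (η : ZMod p) (hη : η + η = 1) {d K M : ℕ}
    (Lst L0 : List (List ℕ × ℕ)) (hM : 2 ≤ M ∧ M < p) (hinv : invCheck p M = true)
    (hrows : ∀ T₀ ∈ L0, rowDead p M Lst L0 T₀ = true)
    (hcomp : ∀ F ∈ compsLB [] p d, ∀ (G : ZMod p → ℕ) (s : ZMod p),
      (∀ σ : ZMod p, (∑ v : ZMod p, (vecFn F (σ - v) + vecFn F (v - σ) + vecFn F (σ + v)) * G v) +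
        (if s = σ then 1 else 0) = K) → (F, s.val) ∈ Lst)
    (hrep : ∀ T ∈ Lst, ∃ k : ℕ, k % p ≠ 0 ∧ ∃ T' ∈ L0, T'.2 % p = k * T.2 % p ∧ ∀ v < p, T'.1.getD (k * v % p) 0 = T.1.getD v 0)
    (hρρ : ∀ a b, ρ a * ρ b = ρ (a + b)) (hρτ : ∀ a b, ρ a * τ b = τ (b - a))
    (hτρ : ∀ a b, τ a * ρ b = τ (a + b)) (hττ : ∀ a b, τ a * τ b = ρ (c₀ + b - a))
    (hρ : Function.Injective ρ) (hτ : Function.Injective τ) (hne : ∀ a b, ρ a ≠ τ b)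
    (hsurj : ∀ g, (∃ a, ρ a = g) ∨ (∃ a, τ a = g))
    (φ : A →+ ZMod p × ZMod p) (hφ : Function.Surjective φ) (hA : Fintype.card A = p * K)
    (h : TripleProductProperty S T U)
    (hS₀ : (univ.filter fun a : A => ρ a ∈ S).card = 1) (hS₁ : (univ.filter fun a : A => τ a ∈ S).card = 1)
    (hT₀ : (univ.filter fun a : A => ρ a ∈ T).card = d) (hT₁ : (univ.filter fun a : A => τ a ∈ T).card = d)
    (hU : (univ.filter fun a : A => ρ a ∈ U).card = (univ.filter fun a : A => τ a ∈ U).card)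
    (hV : 3 * (S.card * T.card * U.card) + 8 = 8 * Fintype.card A) : False := by
  classical
  obtain ⟨X, Y, β, γ, x₀, hXc, -, hinj, hPQ, hPR, hQR, hcover⟩ :=
    domino_shifted_form_of_law hρρ hρτ hτρ hττ hρ hτ hne hsurj h hS₀ hS₁ (by rw [hT₀, hT₁]) hU hV
  rw [hT₀] at hXc
  exact no_shifted_form_of_onto_zpzp_of_consist η hη φ hφ hXc hA Lst L0 hM hinv hrows hcomp hrep hinj hPQ hPR hQR hcover

/-- **No `(1,1 | d,d | e,e)` law triple over `A ↠ ℤ_p × ℤ_p` (`|A| = p·K`) from a consistency certificate for part `e`**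
(the `e`-parts in `U`). [folklore] -/
theorem no_law_cube_1d_e_of_onto_zpzp_of_consist (η : ZMod p) (hη : η + η = 1) {e K M : ℕ}
    (Lst L0 : List (List ℕ × ℕ)) (hM : 2 ≤ M ∧ M < p) (hinv : invCheck p M = true)
    (hrows : ∀ T₀ ∈ L0, rowDead p M Lst L0 T₀ = true)
    (hcomp : ∀ F ∈ compsLB [] p e, ∀ (G : ZMod p → ℕ) (s : ZMod p),
      (∀ σ : ZMod p, (∑ v : ZMod p, (vecFn F (σ - v) + vecFn F (v - σ) + vecFn F (σ + v)) * G v) +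
        (if s = σ then 1 else 0) = K) → (F, s.val) ∈ Lst)
    (hrep : ∀ T ∈ Lst, ∃ k : ℕ, k % p ≠ 0 ∧ ∃ T' ∈ L0, T'.2 % p = k * T.2 % p ∧ ∀ v < p, T'.1.getD (k * v % p) 0 = T.1.getD v 0)
    (hρρ : ∀ a b, ρ a * ρ b = ρ (a + b)) (hρτ : ∀ a b, ρ a * τ b = τ (b - a))
    (hτρ : ∀ a b, τ a * ρ b = τ (a + b)) (hττ : ∀ a b, τ a * τ b = ρ (c₀ + b - a))
    (hρ : Function.Injective ρ) (hτ : Function.Injective τ) (hne : ∀ a b, ρ a ≠ τ b)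
    (hsurj : ∀ g, (∃ a, ρ a = g) ∨ (∃ a, τ a = g))
    (φ : A →+ ZMod p × ZMod p) (hφ : Function.Surjective φ) (hA : Fintype.card A = p * K)
    (h : TripleProductProperty S T U)
    (hS₀ : (univ.filter fun a : A => ρ a ∈ S).card = 1) (hS₁ : (univ.filter fun a : A => τ a ∈ S).card = 1)
    (hT : (univ.filter fun a : A => ρ a ∈ T).card = (univ.filter fun a : A => τ a ∈ T).card)
    (hU₀ : (univ.filter fun a : A => ρ a ∈ U).card = e) (hU₁ : (univ.filter fun a : A => τ a ∈ U).card = e)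
    (hV : 3 * (S.card * T.card * U.card) + 8 = 8 * Fintype.card A) : False := by
  classical
  obtain ⟨X, Y, β, γ, x₀, -, hYc, hinj, hPQ, hPR, hQR, hcover⟩ :=
    domino_shifted_form_of_law hρρ hρτ hτρ hττ hρ hτ hne hsurj h hS₀ hS₁ hT (by rw [hU₀, hU₁]) hV
  rw [hU₀] at hYc
  exact no_shifted_form_of_onto_zpzp_of_consist' η hη φ hφ hYc hA Lst L0 hM hinv hrows hcomp hrep hinj hPQ hPR hQR hcover

end DihedralLike

end ZpZpDomino

end Summit.MatrixMultiplication.OmegaCensus
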